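import Mathlib
import HarnessLib
import Summits.PneNP.PneNP.Theorems.AeaCutRectanglesTransversalEngine
import Summits.PneNP.PneNP.Theses.AeaCutRectangles

/-!
# Route AeaCutRectangles — crux `FoolingMeasure` (stmt-PneNP-19727): DUTY RECTANGLES
# (the maximal cut rectangles inside NON-3-COL, a non-product fooling engine, and X1 in "duty form")

X1 `Summit.PneNP.PneNP.Theses.AeaCutRectangles.FoolingMeasure` quantifies over ALL cut rectangles
`𝓐 ⊗ 𝓑` over a near-balanced cut `B` inside NON-3-COL (Alice holds the edges meeting `V ∖ B`, Bob the
edges inside `B`).  This file determines the MAXIMAL such rectangles exactly.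

For a set `Φ` of colourings `c : V → Fin 3` ("Bob's duty") the DUTY RECTANGLE `dutyRect B Φ` is the set of
loopless edge sets `G` such that
* every `c ∈ Φ` is killed by Bob: some edge of `G` inside `B` is `c`-monochromatic, and
* every `c ∉ Φ` is killed by Alice: some edge of `G` meeting `V ∖ B` is `c`-monochromatic.

Results (all sorry-free):
* `colorable_iff_exists_not_mem_killSet` — the bridge `fromEdgeSet`-3-colourability ↔ colourings killing no edge;
* `union_mem_dutyRect` — ENVELOPE: every cut rectangle `𝓐 ⊗ 𝓑` over `B` inside NON-3-COL (X1's three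
  hypotheses verbatim) satisfies `α ∪ β ∈ dutyRect B (bobDuty 𝓑)` for all `α ∈ 𝓐`, `β ∈ 𝓑`, where
  `bobDuty 𝓑 = {c | c kills every β ∈ 𝓑}`;
* `hybrid_not_colorable` — duty rectangles ARE cut rectangles inside NON-3-COL: Alice's side of one member
  with Bob's side of another is never 3-colourable; `dutyRect_eq_union_sides`;
* `rect_sum_le_dutySum` — the NON-PRODUCT ENGINE: for every `μ ≥ 0`,
  `∑_{(α,β) ∈ 𝓐 ×ˢ 𝓑} μ (α ∪ β) ≤ ∑_{G ∈ dutyFinset B (bobDuty 𝓑)} μ G`;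
* `dutySum_le_of_rectClause` — conversely X1's rectangle clause at `B` bounds every duty mass;
* `foolingMeasure_iff_duty` — hence X1 ⟺ its DUTY FORM: the same measure clause with "every cut rectangle"
  replaced by "every duty rectangle `dutyRect B Φ`, `Φ ⊆ (Fin n → Fin 3)`".  Provers owe
  `sup_Φ μ(dutyRect B Φ) ≤ 2^{-(n/2)·log₂ n - C·n}`; refuters look for ONE heavy pair `(B, Φ)`.

Why this matters for the crux: the transversal engine (`AeaCutRectanglesTransversalEngine`, one bit per
split unit of a product measure) is the special case `Φ ∋ c_u ↦` "side of unit `u`"; the duty form is the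
exact LP-dual object for arbitrary (non-product) measures, which WITNESS-g1 §7(3) asks for.

HONEST FRAMING: elementary finite combinatorics (a covering/duality bookkeeping step of a communication-
complexity style fooling argument); FRONTIER material for a rung of Fagin's complement ladder (NON-3-COL vs.
ESO(∀∃∀)); nothing here bears on P vs NP.

Sources: programme archive 2001, pnp/generalized-spectra-complement/work/aea/AEA.md Thm 4.2 (CLAIM), Rem 4.4
(★★); E. Kushilevitz, N. Nisan, *Communication Complexity* (CUP 1997) §1.2–§2.1 (rectangles, covers).
-/

set_option linter.dupNamespace false -- `Summit.PneNP.PneNP.…`: summit = sub-problem name (D-0017 single-conjunct layout)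

namespace Summit.PneNP.PneNP.Theorems.AeaCutRectanglesDutyRectangles

open Finset
open Summit.PneNP.PneNP.Theorems.AeaCutRectanglesTransversalEngine (parts_unique)

variable {V : Type*}

/-! ### Monochromatic edges, killing sets, and the colourability bridge -/

/-- `s(a, b)` is monochromatic under `c` (its image under `c` is a loop) iff `c a = c b`. -/
theorem map_mk_isDiag_iff {κ : Type*} (c : V → κ) (a b : V) : ((s(a, b)).map c).IsDiag ↔ c a = c b := by
  simp

/-- The KILLING SET of an edge set `S`: the colourings `c : V → Fin 3` under which some non-loop edge of `S` is
monochromatic (i.e. `c` is not a proper colouring of the graph of `S`). -/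
def killSet (S : Finset (Sym2 V)) : Set (V → Fin 3) :=
  {c | ∃ e ∈ S, ¬ e.IsDiag ∧ (e.map c).IsDiag}

/-- Unfolding `killSet`. -/
theorem mem_killSet {S : Finset (Sym2 V)} {c : V → Fin 3} :
    c ∈ killSet S ↔ ∃ e ∈ S, ¬ e.IsDiag ∧ (e.map c).IsDiag := Iff.rfl

/-- Killing is monotone in the edge set. -/
theorem killSet_mono {S T : Finset (Sym2 V)} (hST : S ⊆ T) : killSet S ⊆ killSet T := by
  rintro c ⟨e, he, hd, hm⟩
  exact ⟨e, hST he, hd, hm⟩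

/-- A colouring killing `S ∪ T` kills `S` or `T`. -/
theorem mem_killSet_union [DecidableEq V] {S T : Finset (Sym2 V)} {c : V → Fin 3}
    (h : c ∈ killSet (S ∪ T)) : c ∈ killSet S ∨ c ∈ killSet T := by
  obtain ⟨e, he, hd, hm⟩ := h
  rcases mem_union.1 he with he | he
  · exact Or.inl ⟨e, he, hd, hm⟩
  · exact Or.inr ⟨e, he, hd, hm⟩

/-- **Colourability bridge.** The graph of an edge set (`fromEdgeSet` drops loops) is 3-colourable iff some
colouring `V → Fin 3` lies outside its killing set. -/
theorem colorable_iff_exists_not_mem_killSet (S : Finset (Sym2 V)) :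
    (SimpleGraph.fromEdgeSet (S : Set (Sym2 V))).Colorable 3 ↔ ∃ c : V → Fin 3, c ∉ killSet S := by
  constructor
  · rintro ⟨col⟩
    refine ⟨col, ?_⟩
    rintro ⟨e, he, hd, hm⟩
    induction e using Sym2.ind with
    | h a b =>
      have hab : a ≠ b := fun h => hd (Sym2.mk_isDiag_iff.2 h)
      have hadj : (SimpleGraph.fromEdgeSet (S : Set (Sym2 V))).Adj a b :=
        (SimpleGraph.fromEdgeSet_adj _).2 ⟨mem_coe.2 he, hab⟩
      exact col.valid hadj ((map_mk_isDiag_iff _ a b).1 hm)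
  · rintro ⟨c, hc⟩
    refine ⟨SimpleGraph.Coloring.mk c fun {a b} hadj => ?_⟩
    obtain ⟨hmem, hab⟩ := (SimpleGraph.fromEdgeSet_adj _).1 hadj
    intro heq
    exact hc ⟨s(a, b), mem_coe.1 hmem, fun h => hab (Sym2.mk_isDiag_iff.1 h),
      (map_mk_isDiag_iff c a b).2 heq⟩

/-- An edge set is NOT 3-colourable iff every colouring kills it. -/
theorem not_colorable_iff_forall_mem_killSet (S : Finset (Sym2 V)) :
    ¬ (SimpleGraph.fromEdgeSet (S : Set (Sym2 V))).Colorable 3 ↔ ∀ c : V → Fin 3, c ∈ killSet S := by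
  rw [colorable_iff_exists_not_mem_killSet]
  simp only [not_exists, not_not]

/-! ### The two sides of a cut and the duty rectangles -/

section Sides

variable [Fintype V] [DecidableEq V]

/-- Alice's side of `G` over the cut `B`: the edges of `G` meeting `V ∖ B`. -/
def aliceSide (B : Finset V) (G : Finset (Sym2 V)) : Finset (Sym2 V) :=
  G.filter fun e => ∃ v ∈ e, v ∉ B

/-- Bob's side of `G` over the cut `B`: the edges of `G` inside `B`. -/
def bobSide (B : Finset V) (G : Finset (Sym2 V)) : Finset (Sym2 V) :=
  G.filter fun e => ∀ v ∈ e, v ∈ B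

omit [Fintype V] in
/-- Membership in Alice's side. -/
theorem mem_aliceSide [Fintype V] {B : Finset V} {G : Finset (Sym2 V)} {e : Sym2 V} :
    e ∈ aliceSide B G ↔ e ∈ G ∧ ∃ v ∈ e, v ∉ B := mem_filter

omit [Fintype V] in
/-- Membership in Bob's side. -/
theorem mem_bobSide [Fintype V] {B : Finset V} {G : Finset (Sym2 V)} {e : Sym2 V} :
    e ∈ bobSide B G ↔ e ∈ G ∧ ∀ v ∈ e, v ∈ B := mem_filter

/-- Every edge set is the union of its two sides. -/
theorem aliceSide_union_bobSide (B : Finset V) (G : Finset (Sym2 V)) :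
    aliceSide B G ∪ bobSide B G = G := by
  ext e
  simp only [mem_union, mem_aliceSide, mem_bobSide]
  constructor
  · rintro (⟨h, _⟩ | ⟨h, _⟩) <;> exact h
  · intro h
    by_cases hin : ∀ v ∈ e, v ∈ B
    · exact Or.inr ⟨h, hin⟩
    · push Not at hin
      exact Or.inl ⟨h, hin⟩

end Sides

/-- The DUTY RECTANGLE of Bob's duty `Φ` over the cut `B`: the loopless edge sets in which the edges inside
`B` kill every colouring in `Φ` and the edges meeting `V ∖ B` kill every colouring outside `Φ`. -/
def dutyRect (B : Finset V) (Φ : Set (V → Fin 3)) : Set (Finset (Sym2 V)) :=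
  {G | (∀ e ∈ G, ¬ e.IsDiag) ∧
       (∀ c ∈ Φ, ∃ e ∈ G, (∀ v ∈ e, v ∈ B) ∧ (e.map c).IsDiag) ∧
       (∀ c ∉ Φ, ∃ e ∈ G, (∃ v ∈ e, v ∉ B) ∧ (e.map c).IsDiag)}

/-- Unfolding `dutyRect`. -/
theorem mem_dutyRect {B : Finset V} {Φ : Set (V → Fin 3)} {G : Finset (Sym2 V)} :
    G ∈ dutyRect B Φ ↔ (∀ e ∈ G, ¬ e.IsDiag) ∧
       (∀ c ∈ Φ, ∃ e ∈ G, (∀ v ∈ e, v ∈ B) ∧ (e.map c).IsDiag) ∧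
       (∀ c ∉ Φ, ∃ e ∈ G, (∃ v ∈ e, v ∉ B) ∧ (e.map c).IsDiag) := Iff.rfl

/-- BOB'S DUTY induced by a family `𝓑` of inside parts: the colourings killed by EVERY member of `𝓑`. -/
def bobDuty (𝓑 : Finset (Finset (Sym2 V))) : Set (V → Fin 3) :=
  {c | ∀ β ∈ 𝓑, c ∈ killSet β}

/-- Unfolding `bobDuty`. -/
theorem mem_bobDuty {𝓑 : Finset (Finset (Sym2 V))} {c : V → Fin 3} :
    c ∈ bobDuty 𝓑 ↔ ∀ β ∈ 𝓑, c ∈ killSet β := Iff.rfl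

/-! ### Envelope: every cut rectangle inside NON-3-COL lies in a duty rectangle -/

/-- **ENVELOPE.**  For a cut rectangle `𝓐 ⊗ 𝓑` over `B` inside NON-3-COL (X1's three hypotheses, letter for
letter) every member `α ∪ β` lies in the duty rectangle of `bobDuty 𝓑`.  [If `c` is killed by every `β' ∈ 𝓑`
it is killed inside `B` by `β`; otherwise some `β₀ ∈ 𝓑` spares it, and since `α ∪ β₀` is not 3-colourable
`c` is killed by an edge of `α`, which meets `V ∖ B`.] -/
theorem union_mem_dutyRect [DecidableEq V] {B : Finset V} {𝓐 𝓑 : Finset (Finset (Sym2 V))}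
    (h𝓐 : ∀ α ∈ 𝓐, ∀ e ∈ α, ¬ e.IsDiag ∧ ∃ v ∈ e, v ∉ B)
    (h𝓑 : ∀ β ∈ 𝓑, ∀ e ∈ β, ¬ e.IsDiag ∧ ∀ v ∈ e, v ∈ B)
    (hN : ∀ α ∈ 𝓐, ∀ β ∈ 𝓑,
      ¬ (SimpleGraph.fromEdgeSet ((α ∪ β : Finset (Sym2 V)) : Set (Sym2 V))).Colorable 3)
    {α β : Finset (Sym2 V)} (hα : α ∈ 𝓐) (hβ : β ∈ 𝓑) :
    α ∪ β ∈ dutyRect B (bobDuty 𝓑) := by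
  refine ⟨fun e he => ?_, fun c hc => ?_, fun c hc => ?_⟩
  · rcases mem_union.1 he with he | he
    · exact (h𝓐 α hα e he).1
    · exact (h𝓑 β hβ e he).1
  · obtain ⟨e, he, -, hm⟩ := hc β hβ
    exact ⟨e, mem_union_right _ he, (h𝓑 β hβ e he).2, hm⟩
  · rw [mem_bobDuty] at hc
    push Not at hc
    obtain ⟨β₀, hβ₀, hc⟩ := hc
    have hk : c ∈ killSet (α ∪ β₀) := (not_colorable_iff_forall_mem_killSet _).1 (hN α hα β₀ hβ₀) c
    rcases mem_killSet_union hk with ⟨e, he, -, hm⟩ | hk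
    · exact ⟨e, mem_union_left _ he, (h𝓐 α hα e he).2, hm⟩
    · exact (hc hk).elim

/-! ### Duty rectangles are cut rectangles inside NON-3-COL -/

section Rect

variable [Fintype V] [DecidableEq V]

/-- **Duty rectangles are rectangles inside NON-3-COL**: Alice's side of any member together with Bob's side
of any (other) member is not 3-colourable — a colouring in `Φ` is killed by the second graph's edges inside
`B`, one outside `Φ` by the first graph's edges meeting `V ∖ B`. -/
theorem hybrid_not_colorable {B : Finset V} {Φ : Set (V → Fin 3)} {G G' : Finset (Sym2 V)}
    (hG : G ∈ dutyRect B Φ) (hG' : G' ∈ dutyRect B Φ) :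
    ¬ (SimpleGraph.fromEdgeSet
        ((aliceSide B G ∪ bobSide B G' : Finset (Sym2 V)) : Set (Sym2 V))).Colorable 3 := by
  rw [not_colorable_iff_forall_mem_killSet]
  intro c
  by_cases hc : c ∈ Φ
  · obtain ⟨e, he, hin, hm⟩ := hG'.2.1 c hc
    exact ⟨e, mem_union_right _ (mem_bobSide.2 ⟨he, hin⟩), hG'.1 e he, hm⟩
  · obtain ⟨e, he, hout, hm⟩ := hG.2.2 c hc
    exact ⟨e, mem_union_left _ (mem_aliceSide.2 ⟨he, hout⟩), hG.1 e he, hm⟩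

/-- In particular every member of a duty rectangle is non-3-colourable. -/
theorem not_colorable_of_mem_dutyRect {B : Finset V} {Φ : Set (V → Fin 3)} {G : Finset (Sym2 V)}
    (hG : G ∈ dutyRect B Φ) :
    ¬ (SimpleGraph.fromEdgeSet (G : Set (Sym2 V))).Colorable 3 := by
  have h := hybrid_not_colorable hG hG
  rwa [aliceSide_union_bobSide] at h

/-- The finite set of members of a duty rectangle (over a finite vertex type). -/
noncomputable def dutyFinset (B : Finset V) (Φ : Set (V → Fin 3)) : Finset (Finset (Sym2 V)) := by
  classical exact univ.filter fun G => G ∈ dutyRect B Φ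

omit [DecidableEq V] in
/-- Membership in `dutyFinset`. -/
theorem mem_dutyFinset {B : Finset V} {Φ : Set (V → Fin 3)} {G : Finset (Sym2 V)} :
    G ∈ dutyFinset B Φ ↔ G ∈ dutyRect B Φ := by
  classical
  simp [dutyFinset]

/-- The family of Alice's sides of a duty rectangle. -/
noncomputable def dutyAlice (B : Finset V) (Φ : Set (V → Fin 3)) : Finset (Finset (Sym2 V)) :=
  (dutyFinset B Φ).image (aliceSide B)

/-- The family of Bob's sides of a duty rectangle. -/
noncomputable def dutyBob (B : Finset V) (Φ : Set (V → Fin 3)) : Finset (Finset (Sym2 V)) :=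
  (dutyFinset B Φ).image (bobSide B)

/-- `dutyAlice` satisfies X1's hypothesis on `𝓐`: loopless edges, each meeting `V ∖ B`. -/
theorem dutyAlice_hyp {B : Finset V} {Φ : Set (V → Fin 3)} :
    ∀ α ∈ dutyAlice B Φ, ∀ e ∈ α, ¬ e.IsDiag ∧ ∃ v ∈ e, v ∉ B := by
  intro α hα e he
  obtain ⟨G, hG, rfl⟩ := mem_image.1 hα
  obtain ⟨heG, hout⟩ := mem_aliceSide.1 he
  exact ⟨(mem_dutyFinset.1 hG).1 e heG, hout⟩

/-- `dutyBob` satisfies X1's hypothesis on `𝓑`: loopless edges inside `B`. -/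
theorem dutyBob_hyp {B : Finset V} {Φ : Set (V → Fin 3)} :
    ∀ β ∈ dutyBob B Φ, ∀ e ∈ β, ¬ e.IsDiag ∧ ∀ v ∈ e, v ∈ B := by
  intro β hβ e he
  obtain ⟨G, hG, rfl⟩ := mem_image.1 hβ
  obtain ⟨heG, hin⟩ := mem_bobSide.1 he
  exact ⟨(mem_dutyFinset.1 hG).1 e heG, hin⟩

/-- `dutyAlice ⊗ dutyBob` satisfies X1's third hypothesis: all combinations are non-3-colourable. -/
theorem dutyAlice_dutyBob_not_colorable {B : Finset V} {Φ : Set (V → Fin 3)} :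
    ∀ α ∈ dutyAlice B Φ, ∀ β ∈ dutyBob B Φ,
      ¬ (SimpleGraph.fromEdgeSet ((α ∪ β : Finset (Sym2 V)) : Set (Sym2 V))).Colorable 3 := by
  intro α hα β hβ
  obtain ⟨G, hG, rfl⟩ := mem_image.1 hα
  obtain ⟨G', hG', rfl⟩ := mem_image.1 hβ
  exact hybrid_not_colorable (mem_dutyFinset.1 hG) (mem_dutyFinset.1 hG')

/-- **The duty rectangle is the cut rectangle `dutyAlice ⊗ dutyBob`**: its members are exactly the unions
`α ∪ β` with `α ∈ dutyAlice`, `β ∈ dutyBob` (maximality: every cut rectangle inside NON-3-COL sits inside one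
of these, `union_mem_dutyRect`). -/
theorem mem_dutyRect_iff_exists_sides {B : Finset V} {Φ : Set (V → Fin 3)} {G : Finset (Sym2 V)} :
    G ∈ dutyRect B Φ ↔ ∃ α ∈ dutyAlice B Φ, ∃ β ∈ dutyBob B Φ, α ∪ β = G := by
  constructor
  · intro hG
    exact ⟨aliceSide B G, mem_image_of_mem _ (mem_dutyFinset.2 hG), bobSide B G,
      mem_image_of_mem _ (mem_dutyFinset.2 hG), aliceSide_union_bobSide B G⟩
  · rintro ⟨α, hα, β, hβ, rfl⟩
    have h := union_mem_dutyRect dutyAlice_hyp dutyBob_hyp dutyAlice_dutyBob_not_colorable hα hβ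
    -- `dutyRect B (bobDuty (dutyBob B Φ))` and `dutyRect B Φ` may differ as sets of duties, but membership of
    -- `α ∪ β` in the latter is checked directly from the sides:
    obtain ⟨G, hG, rfl⟩ := mem_image.1 hα
    obtain ⟨G', hG', rfl⟩ := mem_image.1 hβ
    have hGd := mem_dutyFinset.1 hG
    have hG'd := mem_dutyFinset.1 hG'
    refine ⟨h.1, fun c hc => ?_, fun c hc => ?_⟩
    · obtain ⟨e, he, hin, hm⟩ := hG'd.2.1 c hc
      exact ⟨e, mem_union_right _ (mem_bobSide.2 ⟨he, hin⟩), hin, hm⟩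
    · obtain ⟨e, he, hout, hm⟩ := hGd.2.2 c hc
      exact ⟨e, mem_union_left _ (mem_aliceSide.2 ⟨he, hout⟩), hout, hm⟩

end Rect

/-! ### The non-product engine: rectangle mass ≤ duty mass, and conversely -/

section Measure

variable [Fintype V] [DecidableEq V]

/-- **NON-PRODUCT FOOLING ENGINE.**  For every `μ ≥ 0` and every cut rectangle `𝓐 ⊗ 𝓑` over `B` inside
NON-3-COL (X1's three hypotheses verbatim), the rectangle mass `∑_{(α,β) ∈ 𝓐 ×ˢ 𝓑} μ (α ∪ β)` is at most the
mass of the duty rectangle of `bobDuty 𝓑`.  So a measure whose every DUTY rectangle is light fools every cut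
rectangle. -/
theorem rect_sum_le_dutySum (μ : Finset (Sym2 V) → ℝ) (hμ : ∀ S, 0 ≤ μ S) {B : Finset V}
    (𝓐 𝓑 : Finset (Finset (Sym2 V)))
    (h𝓐 : ∀ α ∈ 𝓐, ∀ e ∈ α, ¬ e.IsDiag ∧ ∃ v ∈ e, v ∉ B)
    (h𝓑 : ∀ β ∈ 𝓑, ∀ e ∈ β, ¬ e.IsDiag ∧ ∀ v ∈ e, v ∈ B)
    (hN : ∀ α ∈ 𝓐, ∀ β ∈ 𝓑,
      ¬ (SimpleGraph.fromEdgeSet ((α ∪ β : Finset (Sym2 V)) : Set (Sym2 V))).Colorable 3) :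
    ∑ q ∈ 𝓐 ×ˢ 𝓑, μ (q.1 ∪ q.2) ≤ ∑ G ∈ dutyFinset B (bobDuty 𝓑), μ G := by
  have hinj : ∀ q ∈ 𝓐 ×ˢ 𝓑, ∀ q' ∈ 𝓐 ×ˢ 𝓑, q.1 ∪ q.2 = q'.1 ∪ q'.2 → q = q' := by
    intro q hq q' hq' h
    obtain ⟨hq1, hq2⟩ := mem_product.1 hq
    obtain ⟨hq1', hq2'⟩ := mem_product.1 hq'
    obtain ⟨h1, h2⟩ := parts_unique h (fun e he => (h𝓐 _ hq1 e he).2) (fun e he => (h𝓐 _ hq1' e he).2)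
      (fun e he => (h𝓑 _ hq2 e he).2) (fun e he => (h𝓑 _ hq2' e he).2)
    exact Prod.ext h1 h2
  rw [← sum_image hinj]
  refine sum_le_sum_of_subset_of_nonneg (fun G hG => ?_) fun G _ _ => hμ G
  obtain ⟨q, hq, rfl⟩ := mem_image.1 hG
  obtain ⟨hq1, hq2⟩ := mem_product.1 hq
  exact mem_dutyFinset.2 (union_mem_dutyRect h𝓐 h𝓑 hN hq1 hq2)

/-- **Converse**: X1's rectangle clause at the cut `B` with bound `δ` (for `μ ≥ 0`) bounds the mass of every
duty rectangle over `B` by `δ` — apply the clause to the cut rectangle `dutyAlice ⊗ dutyBob`. -/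
theorem dutySum_le_of_rectClause (μ : Finset (Sym2 V) → ℝ) (hμ : ∀ S, 0 ≤ μ S) {B : Finset V} {δ : ℝ}
    (hclause : ∀ 𝓐 𝓑 : Finset (Finset (Sym2 V)),
      (∀ α ∈ 𝓐, ∀ e ∈ α, ¬ e.IsDiag ∧ ∃ v ∈ e, v ∉ B) →
      (∀ β ∈ 𝓑, ∀ e ∈ β, ¬ e.IsDiag ∧ ∀ v ∈ e, v ∈ B) →
      (∀ α ∈ 𝓐, ∀ β ∈ 𝓑,
        ¬ (SimpleGraph.fromEdgeSet ((α ∪ β : Finset (Sym2 V)) : Set (Sym2 V))).Colorable 3) →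
      ∑ q ∈ 𝓐 ×ˢ 𝓑, μ (q.1 ∪ q.2) ≤ δ)
    (Φ : Set (V → Fin 3)) : ∑ G ∈ dutyFinset B Φ, μ G ≤ δ := by
  refine le_trans ?_ (hclause (dutyAlice B Φ) (dutyBob B Φ) dutyAlice_hyp dutyBob_hyp
    dutyAlice_dutyBob_not_colorable)
  -- `G ↦ (aliceSide G, bobSide G)` injects the duty rectangle into `dutyAlice ×ˢ dutyBob`
  set s : Finset (Sym2 V) → Finset (Sym2 V) × Finset (Sym2 V) := fun G => (aliceSide B G, bobSide B G)
    with hs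
  have hinj : ∀ G ∈ dutyFinset B Φ, ∀ G' ∈ dutyFinset B Φ, s G = s G' → G = G' := by
    intro G _ G' _ h
    have h1 : aliceSide B G = aliceSide B G' := congrArg Prod.fst h
    have h2 : bobSide B G = bobSide B G' := congrArg Prod.snd h
    rw [← aliceSide_union_bobSide B G, ← aliceSide_union_bobSide B G', h1, h2]
  have hval : ∀ G ∈ dutyFinset B Φ, μ G = μ ((s G).1 ∪ (s G).2) := fun G _ => by
    simp only [hs, aliceSide_union_bobSide]
  rw [sum_congr rfl hval, ← sum_image (f := fun q => μ (q.1 ∪ q.2)) hinj]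
  refine sum_le_sum_of_subset_of_nonneg (fun q hq => ?_) fun q _ _ => hμ _
  obtain ⟨G, hG, rfl⟩ := mem_image.1 hq
  exact mem_product.2 ⟨mem_image_of_mem _ hG, mem_image_of_mem _ hG⟩

end Measure

/-! ### X1 in duty form -/

/-- **X1 ⟺ its DUTY FORM.**  The crux `FoolingMeasure` holds iff (same `ε`, same `C ↦ n` schedule, same `μ`)
some probability measure on loopless non-3-colourable edge sets makes every DUTY rectangle `dutyRect B Φ`
(`Φ` any set of colourings `Fin n → Fin 3`) over every near-balanced cut `B` light:
`∑_{G ∈ dutyFinset B Φ} μ G ≤ 2^(-(n/2)·log₂ n - C·n)`.  (`→`: `dutySum_le_of_rectClause`; `←`: the non-product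
engine `rect_sum_le_dutySum`.)  Constructing provers owe the right-hand side; refuters need ONE heavy `(B, Φ)`. -/
theorem foolingMeasure_iff_duty :
    Summit.PneNP.PneNP.Theses.AeaCutRectangles.FoolingMeasure ↔
    ∃ ε : ℝ, 0 < ε ∧ ε ≤ 1 / 4 ∧ ∀ C : ℕ, ∃ᶠ n in Filter.atTop, ∃ μ : Finset (Sym2 (Fin n)) → ℝ,
      (∀ S, 0 ≤ μ S) ∧ (∑ S, μ S = 1) ∧
      (∀ S, μ S ≠ 0 → (∀ e ∈ S, ¬ e.IsDiag) ∧
        ¬ (SimpleGraph.fromEdgeSet (S : Set (Sym2 (Fin n)))).Colorable 3) ∧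
      ∀ B : Finset (Fin n), (1 / 2 - ε) * (n : ℝ) ≤ B.card → (B.card : ℝ) ≤ (1 / 2 + ε) * n →
        ∀ Φ : Set (Fin n → Fin 3),
          ∑ G ∈ dutyFinset B Φ, μ G ≤ (2 : ℝ) ^ (-((n : ℝ) / 2 * Real.logb 2 n) - (C : ℝ) * n) := by
  constructor
  · rintro ⟨ε, hε0, hε1, hC⟩
    refine ⟨ε, hε0, hε1, fun C => (hC C).mono fun n hn => ?_⟩
    obtain ⟨μ, h0, h1, hs, hr⟩ := hn
    refine ⟨μ, h0, h1, hs, fun B hB1 hB2 Φ => ?_⟩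
    exact dutySum_le_of_rectClause μ h0 (hr B hB1 hB2) Φ
  · rintro ⟨ε, hε0, hε1, hC⟩
    refine ⟨ε, hε0, hε1, fun C => (hC C).mono fun n hn => ?_⟩
    obtain ⟨μ, h0, h1, hs, hr⟩ := hn
    refine ⟨μ, h0, h1, hs, fun B hB1 hB2 𝓐 𝓑 h𝓐 h𝓑 hN => ?_⟩
    exact (rect_sum_le_dutySum μ h0 𝓐 𝓑 h𝓐 h𝓑 hN).trans (hr B hB1 hB2 (bobDuty 𝓑))

end Summit.PneNP.PneNP.Theorems.AeaCutRectanglesDutyRectangles
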